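import Summits.CriticalPhenomena.PercolationContinuityZ3.Theorems.PercNearOneGluingNoHeavyRsw3WMSFNoBranching
import Summits.CriticalPhenomena.PercolationContinuityZ3.Theorems.PercNearOneGluingNoHeavyRsw3CouplingMerging
import Summits.CriticalPhenomena.PercolationContinuityZ3.Theorems.PercNearOneGluingNoHeavyRsw3InvasionBackboneLabels
import HarnessLib

/-!
# RSW3 lane (P2, gen 30): THE WIRED MINIMAL SPANNING FOREST, VI — **EVERY COMPONENT OF `𝔉_w(ℤ^d)` HAS EXACTLY ONE END** (`d ≥ 2`; Lyons–Peres 2016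
# Thm. 11.12 = Lyons–Peres–Schramm 2006 Thm. 3.12 in full, on `ℤ^d`, via p205010)

builds on p205010 (kernel theorem, internal audit signed; external expert review pending) — used for `θ(p_c) = 0` (no infinite critical cluster; backbones).

Cell `prim-rsw3`, prover seat `prim-rsw3-p2` (gen 30), memo `run/shared/lean/prim/rsw3/P2-RSWLITE.md` §37.  Support file
(`--supports stmt-CriticalPhenomena-4575`); no definitions, no named facts, no sorries.  Last file of the programme (files I–V: orientation, trunk, measurability,
identification, no branching).  Lyons–Peres' second mass transport: on a component with a second end the trunk carries a bond with label `> p_c` (else an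
infinite `p_c`-open path, impossible by `θ(p_c) = 0`), hence for a rational `t > p_c` a MARKED trunk vertex — the up-most one whose parent bond has label `> t`
(labels up a backbone are eventually `≤ t`); marked vertices are unique per component (no branching, file V), so transporting unit mass from every vertex of
the component to it gives infinite expected in-mass against out-mass `≤ 1`: contradiction with the mass-transport principle.  Hence NO trunk, hence ONE END.

* §1 (deterministic, good label field): `rayField_props` (the backbone field of a good label field is a coherent tail-sharing ray field of the acyclic `𝔉_w`);
  **`marked_iff`** (the measurable "marked at level `t`" event, written with `ξ` and constrained forest clusters, is file II's marked notion);
  `encard_marked_le_one` (under no branching: at most one marked vertex per component); `infinite_component` (components are infinite).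
* §2 **`ae_not_marked`** (`ℤ^d`): almost surely no vertex is marked at a given level (mass transport).
* §3 **`ae_wmsf_oneEnded`**: almost surely, for every `v ∈ ℤ^d` there is EXACTLY ONE self-avoiding ray from `v` in `𝔉_w(U)` — every component of the wired
  minimal spanning forest of `ℤ^d` has exactly one end (`d ≥ 2`; new for `3 ≤ d ≤ 6`, where `θ(p_c) = 0` is p205010); `ae_wmsf_oneEnded_Z3`.

References: R. Lyons, Y. Peres, *Probability on Trees and Networks* (2016), Thm. 11.12 and its proof, §8.1 [LyonsPeres2016]; R. Lyons, Y. Peres, O. Schramm,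
Ann. Probab. 34 (2006) Thm. 1.1 / Thm. 3.12 [LyonsPeresSchramm2006].
-/

noncomputable section

namespace Summit.CriticalPhenomena.PercolationContinuityZ3.Theorems.Rsw3

open Finset Filter MeasureTheory Literature.Probability.LatticeModels Literature.Probability.Percolation
open Literature.Probability.Percolation.Invasion Literature.Barriers.CriticalPhenomena
open scoped ENNReal

section General

variable {V : Type*} [DecidableEq V] {G : SimpleGraph V} [G.LocallyFinite]

/-! ## §1 Deterministic: the backbone field, marked vertices -/

/-- **The backbone field of a good label field is a coherent tail-sharing ray field of the forest `𝔉_w`** (files I, XXXIX): for injective labels with outlets beyond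
every time and a unique backbone `R v` at every vertex: `𝔉_w` is acyclic, `R v 0 = v`, `R v` injective and `𝔉_w`-adjacent, `R (R v i) k = R v (i+k)`, and
`𝔉_w`-adjacent / `𝔉_w`-connected vertices have tail-sharing backbones. [cite: LyonsPeresSchramm2006, Thm. 3.12 (proof)] -/
theorem rayField_props [Infinite V] (hG : G.Preconnected) {U : Sym2 V → ℝ} (hU : Function.Injective U)
    (hout : ∀ v : V, ∀ k, ∃ m, k ≤ m ∧ IsOutlet G U v m)
    (hray : ∀ v : V, ∃! R : ℕ → V, Function.Injective R ∧ R 0 = v ∧ ∀ i, (tree G U v).Adj (R i) (R (i + 1)))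
    {R : V → ℕ → V} (hRspec : ∀ v, Function.Injective (R v) ∧ R v 0 = v ∧ ∀ i, (tree G U v).Adj (R v i) (R v (i + 1))) :
    (openGraph (wmsf G U)).IsAcyclic ∧ (∀ v, R v 0 = v) ∧ (∀ v, Function.Injective (R v)) ∧
      (∀ v i, (openGraph (wmsf G U)).Adj (R v i) (R v (i + 1))) ∧ (∀ v i k, R (R v i) k = R v (i + k)) ∧
      (∀ x y : V, (openGraph (wmsf G U)).Adj x y → ∃ a b, ∀ k, R x (a + k) = R y (b + k)) ∧
      (∀ x y : V, (openGraph (wmsf G U)).Reachable x y → ∃ a b, ∀ k, R x (a + k) = R y (b + k)) := by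
  have hUi : Set.InjOn U G.edgeSet := hU.injOn
  have hex : ∀ v : V, ∃ R : ℕ → V, Function.Injective R ∧ R 0 = v ∧ ∀ i, (tree G U v).Adj (R i) (R (i + 1)) := fun v => (hray v).exists
  refine ⟨wmsf_isAcyclic U, fun v => (hRspec v).2.1, fun v => (hRspec v).1, fun v i => tree_le_fromEdgeSet_wmsf hUi v ((hRspec v).2.2 i),
    fun v i k => ray_coherent hG hU hout hex (hRspec v).1 (hRspec v).2.1 (hRspec v).2.2 i (hRspec _).1 (hRspec _).2.1 (hRspec _).2.2 k,
    fun x z hxz => ?_, fun x z hxz => ?_⟩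
  · rw [openGraph_adj] at hxz
    exact rays_tail_equivalent_of_mem_wmsf hG hU hxz.1 (hout x) (hRspec x).1 (hRspec x).2.1 (hRspec x).2.2 (hRspec z).1 (hRspec z).2.2
  · exact rays_tail_equivalent_of_wmsf_reachable hG hU hout hex hxz (hRspec x).1 (hRspec x).2.1 (hRspec x).2.2 (hRspec z).1 (hRspec z).2.1
      (hRspec z).2.2

/-- **THE MARKED EVENT IS FILE II's MARKED NOTION** (good label field, `R` its backbone field, level `t`): "`w` has a neighbour `y` with `ξ(w, y; T(w))`, `ξ(y, w; 𝔉_w)`,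
`U s(w, y) > t`, and every `z ≠ w` with a neighbour `y'`, `ξ(z, y'; T(z))`, whose forest cluster avoiding `y'` contains `w`, has `U s(z, y') ≤ t`" iff "`w` is a trunk
vertex, `U s(w, par w) > t` and `U s(par^i w, par^{i+1} w) ≤ t` for all `i ≥ 1`". [cite: LyonsPeres2016, Thm. 11.12 (proof: the largest m with U > p_c + ε)] -/
theorem marked_iff [Infinite V] (hG : G.Preconnected) {U : Sym2 V → ℝ} (hU : Function.Injective U)
    (hout : ∀ v : V, ∀ k, ∃ m, k ≤ m ∧ IsOutlet G U v m)
    (hray : ∀ v : V, ∃! R : ℕ → V, Function.Injective R ∧ R 0 = v ∧ ∀ i, (tree G U v).Adj (R i) (R (i + 1)))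
    {R : V → ℕ → V} (hRspec : ∀ v, Function.Injective (R v) ∧ R v 0 = v ∧ ∀ i, (tree G U v).Adj (R v i) (R v (i + 1))) (t : ℝ) (w : V) :
    ((∃ y, InfBranch (treeEdges G U w) w y ∧ InfBranch (wmsf G U) y w ∧ t < U s(w, y)) ∧
      ∀ z, z ≠ w → ∀ y', InfBranch (treeEdges G U z) z y' → w ∈ openClusterIn (withinGraph ⊤ ({y'} : Set V)ᶜ) (wmsf G U) z → U s(z, y') ≤ t) ↔
    ({u | ∃ i, R u i = w}.Infinite ∧ t < U s(w, R w 1) ∧ ∀ i, 1 ≤ i → U s(R w i, R w (i + 1)) ≤ t) := by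
  obtain ⟨hF, h0, hinj, hadjF, hcoh, htail, -⟩ := rayField_props hG hU hout hray hRspec
  have hpar : ∀ z y, InfBranch (treeEdges G U z) z y ↔ y = R z 1 :=
    fun z y => infBranch_treeEdges_iff_eq_ray_one hG (hout z) (hinj z) (h0 z) (hRspec z).2.2 y
  have htrunk : ∀ z, InfBranch (wmsf G U) (R z 1) z ↔ {u | ∃ i, R u i = z}.Infinite :=
    fun z => infBranch_parent_iff_trunk hF h0 hinj hadjF hcoh htail z
  have hdesc : ∀ z u, u ∈ openClusterIn (withinGraph ⊤ ({R z 1} : Set V)ᶜ) (wmsf G U) z ↔ ∃ i, R u i = z :=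
    fun z u => mem_openClusterIn_avoid_parent_iff_desc hF h0 hinj hadjF hcoh htail z u
  constructor
  · rintro ⟨⟨y, hy1, hy2, hyt⟩, hall⟩
    obtain rfl := (hpar w y).1 hy1
    refine ⟨(htrunk w).1 hy2, hyt, fun i hi => ?_⟩
    have hz : R w i ≠ w := fun h => by
      have := hinj w (h.trans (h0 w).symm); omega
    have h := hall (R w i) hz (R (R w i) 1) ((hpar _ _).2 rfl) ((hdesc (R w i) w).2 ⟨i, rfl⟩)
    rwa [hcoh] at h
  · rintro ⟨htr, hwt, hup⟩
    refine ⟨⟨R w 1, (hpar w _).2 rfl, (htrunk w).2 htr, hwt⟩, fun z hz y' hy' hmem => ?_⟩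
    obtain rfl := (hpar z y').1 hy'
    obtain ⟨i, hi⟩ := (hdesc z w).1 hmem
    have hi0 : 1 ≤ i := by
      rcases Nat.eq_zero_or_pos i with rfl | h
      · rw [h0] at hi; exact absurd hi.symm hz
      · exact h
    have := hup i hi0
    rw [← hi, hcoh]
    exact this

/-- **Under no branching at most one vertex of a component is marked** (file II `marked_unique` through `marked_iff`; no branching in the measurable form of file V).
[cite: LyonsPeres2016, Thm. 11.12 (proof)] -/
theorem encard_marked_le_one [Infinite V] (hG : G.Preconnected) {U : Sym2 V → ℝ} (hU : Function.Injective U)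
    (hout : ∀ v : V, ∀ k, ∃ m, k ≤ m ∧ IsOutlet G U v m)
    (hray : ∀ v : V, ∃! R : ℕ → V, Function.Injective R ∧ R 0 = v ∧ ∀ i, (tree G U v).Adj (R i) (R (i + 1)))
    (hnb : ∀ o : V, {w | InfBranch (treeEdges G U w) w o ∧ InfBranch (wmsf G U) o w}.encard ≤ 1) (t : ℝ) (o : V) :
    {w | (openGraph (wmsf G U)).Reachable o w ∧
      ((∃ y, InfBranch (treeEdges G U w) w y ∧ InfBranch (wmsf G U) y w ∧ t < U s(w, y)) ∧
        ∀ z, z ≠ w → ∀ y', InfBranch (treeEdges G U z) z y' →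
          w ∈ openClusterIn (withinGraph ⊤ ({y'} : Set V)ᶜ) (wmsf G U) z → U s(z, y') ≤ t)}.encard ≤ 1 := by
  classical
  have hex : ∀ v : V, ∃ R : ℕ → V, Function.Injective R ∧ R 0 = v ∧ ∀ i, (tree G U v).Adj (R i) (R (i + 1)) := fun v => (hray v).exists
  choose R hR hR0 hRadj using hex
  have hRspec : ∀ v, Function.Injective (R v) ∧ R v 0 = v ∧ ∀ i, (tree G U v).Adj (R v i) (R v (i + 1)) :=
    fun v => ⟨hR v, hR0 v, hRadj v⟩
  obtain ⟨hF, h0, hinj, hadjF, hcoh, htail, htailR⟩ := rayField_props hG hU hout hray hRspec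
  have hpar : ∀ z y, InfBranch (treeEdges G U z) z y ↔ y = R z 1 :=
    fun z y => infBranch_treeEdges_iff_eq_ray_one hG (hout z) (hinj z) (h0 z) (hRadj z) y
  have htrunk : ∀ z, InfBranch (wmsf G U) (R z 1) z ↔ {u | ∃ i, R u i = z}.Infinite :=
    fun z => infBranch_parent_iff_trunk hF h0 hinj hadjF hcoh htail z
  -- no branching in the form of file II
  have hnb' : ∀ m w₁ w₂ : V, R w₁ 1 = m → R w₂ 1 = m → {u | ∃ i, R u i = w₁}.Infinite → {u | ∃ i, R u i = w₂}.Infinite → w₁ = w₂ := by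
    intro m w₁ w₂ h1 h2 hw₁ hw₂
    refine Set.encard_le_one_iff.1 (hnb m) w₁ w₂ ⟨(hpar _ _).2 h1.symm, ?_⟩ ⟨(hpar _ _).2 h2.symm, ?_⟩
    · rw [← h1]; exact (htrunk w₁).2 hw₁
    · rw [← h2]; exact (htrunk w₂).2 hw₂
  refine Set.encard_le_one_iff.2 fun a b ha hb => ?_
  obtain ⟨hra, hma⟩ := ha
  obtain ⟨hrb, hmb⟩ := hb
  obtain ⟨hta, hat, haup⟩ := (marked_iff hG hU hout hray hRspec t a).1 hma
  obtain ⟨htb, hbt, hbup⟩ := (marked_iff hG hU hout hray hRspec t b).1 hmb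
  exact marked_unique h0 hcoh hnb' hta hat haup htb hbt hbup (htailR a b (hra.symm.trans hrb))

/-- **Components of `𝔉_w` are infinite** (they contain a backbone). [cite: LyonsPeresSchramm2006, §3 (every tree of 𝔉_w is infinite)] -/
theorem infinite_component {U : Sym2 V → ℝ} (hU : Set.InjOn U G.edgeSet) {o : V} {R : ℕ → V} (hR : Function.Injective R) (hR0 : R 0 = o)
    (hRadj : ∀ i, (tree G U o).Adj (R i) (R (i + 1))) : {u | (openGraph (wmsf G U)).Reachable u o}.Infinite := by
  refine (Set.infinite_range_of_injective hR).mono ?_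
  rintro _ ⟨k, rfl⟩
  obtain ⟨p, -⟩ := exists_walk_support_eq R (fun i => tree_le_fromEdgeSet_wmsf hU o (hRadj i)) k
  rw [hR0] at p
  exact ⟨p.reverse⟩

end General

/-! ## §2 `ℤ^d`: no marked vertex, by the mass-transport principle -/

variable {d : ℕ}

/-- **Almost surely no vertex of `ℤ^d` is marked at level `t`** (`d ≥ 2`): the transport sending unit mass from `u` to every marked vertex of its forest component has
out-mass `≤ 1` a.s. (no branching, file V) and in-mass `∞ · 1[o marked]` (components are infinite); the mass-transport principle forces `P(o marked) = 0`.
[cite: LyonsPeres2016, Thm. 11.12 (proof: "The vertex x_m would then receive infinite mass")] [cite: LyonsPeres2016, §8.1 (mass-transport principle)] -/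
theorem ae_not_marked (hd : 2 ≤ d) (t : ℝ) :
    ∀ᵐ U ∂(labelMeasure (Site d)), ∀ w : Site d,
      ¬ ((∃ y, InfBranch (treeEdges (zdGraph d) U w) w y ∧ InfBranch (wmsf (zdGraph d) U) y w ∧ t < U s(w, y)) ∧
          ∀ z, z ≠ w → ∀ y', InfBranch (treeEdges (zdGraph d) U z) z y' →
            w ∈ openClusterIn (withinGraph ⊤ ({y'} : Set (Site d))ᶜ) (wmsf (zdGraph d) U) z → U s(z, y') ≤ t) := by
  classical
  haveI : Nonempty (Fin d) := ⟨⟨0, by omega⟩⟩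
  haveI : Infinite (Site d) := Pi.infinite_of_right
  haveI : IsProbabilityMeasure (labelMeasure (Site d)) := isProbabilityMeasure_labelMeasure _
  set G := zdGraph d with hGdef
  -- the marked event and the transport
  set M : (Sym2 (Site d) → ℝ) → Site d → Prop := fun U w =>
    (∃ y, InfBranch (treeEdges G U w) w y ∧ InfBranch (wmsf G U) y w ∧ t < U s(w, y)) ∧
      ∀ z, z ≠ w → ∀ y', InfBranch (treeEdges G U z) z y' →
        w ∈ openClusterIn (withinGraph ⊤ ({y'} : Set (Site d))ᶜ) (wmsf G U) z → U s(z, y') ≤ t with hMdef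
  have hMmeas : ∀ w, Measurable fun U => M U w := by
    intro w
    refine Measurable.and ?_ ?_
    · refine Measurable.exists fun y => ?_
      refine (measurableSet_setOf.1 (measurableSet_infBranch_treeEdges (G := G) w w y)).and
        ((measurableSet_setOf.1 (measurableSet_infBranch_wmsf (G := G) y w)).and ?_)
      exact measurableSet_setOf.1 (measurableSet_lt measurable_const (measurable_pi_apply _))
    · refine Measurable.forall fun z => measurable_const.imp (Measurable.forall fun y' => ?_)
      refine (measurableSet_setOf.1 (measurableSet_infBranch_treeEdges (G := G) z z y')).imp ?_
      refine (measurableSet_setOf.1 (measurableSet_wmsf_openClusterIn (G := G) _ z w)).imp ?_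
      exact measurableSet_setOf.1 (measurableSet_le (measurable_pi_apply _) measurable_const)
  have hMinv : ∀ (γ : G ≃g G) (w : Site d) (U : Sym2 (Site d) → ℝ), Function.Injective U → (M (actLabels γ U) (γ w) ↔ M U w) := by
    intro γ w U hU
    simp only [hMdef]
    refine Iff.and ?_ ?_
    · rw [γ.surjective.exists]
      refine exists_congr fun y => ?_
      rw [infBranch_treeEdges_actLabels_iff γ hU, infBranch_wmsf_actLabels_iff, actLabels_mk]
    · rw [γ.surjective.forall]
      refine forall_congr' fun z => ?_
      rw [γ.injective.ne_iff]
      refine imp_congr_right fun _ => ?_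
      rw [γ.surjective.forall]
      refine forall_congr' fun y' => ?_
      rw [infBranch_treeEdges_actLabels_iff γ hU, mem_openClusterIn_wmsf_actLabels_iff, actLabels_mk]
  set F : Site d → Site d → (Sym2 (Site d) → ℝ) → ℝ≥0∞ := fun u w U =>
    if Function.Injective U ∧ (SimpleGraph.fromEdgeSet (wmsf G U)).Reachable u w ∧ M U w then 1 else 0 with hFdef
  have hFmeas : ∀ u w, Measurable (F u w) := by
    intro u w
    refine Measurable.ite (measurableSet_setOf.2 ?_) measurable_const measurable_const
    exact (measurableSet_setOf.1 measurableSet_injective).and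
      ((measurableSet_setOf.1 (measurableSet_wmsf_reachable (G := G) u w)).and (hMmeas w))
  have hFinv : ∀ (γ : G ≃g G) (u w : Site d) (U : Sym2 (Site d) → ℝ), F (γ u) (γ w) (actLabels γ U) = F u w U := by
    intro γ u w U
    by_cases hU : Function.Injective U
    · have h1 : (Function.Injective (actLabels γ U) ∧ (SimpleGraph.fromEdgeSet (wmsf G (actLabels γ U))).Reachable (γ u) (γ w) ∧
          M (actLabels γ U) (γ w)) ↔ (Function.Injective U ∧ (SimpleGraph.fromEdgeSet (wmsf G U)).Reachable u w ∧ M U w) := by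
        rw [injective_actLabels_iff, wmsf_reachable_actLabels_iff, hMinv γ w U hU]
      simp only [hFdef]
      split_ifs with ha hb hb
      · rfl
      · exact absurd (h1.1 ha) hb
      · exact absurd (h1.2 hb) ha
      · rfl
    · have hU' : ¬ Function.Injective (actLabels γ U) := by rwa [injective_actLabels_iff]
      simp only [hFdef, hU, hU', false_and, if_false]
  -- the mass-transport principle
  have hMTP : ∀ o : Site d, ∫⁻ U, ∑' w, F o w U ∂(labelMeasure (Site d)) = ∫⁻ U, ∑' u, F u o U ∂(labelMeasure (Site d)) :=
    fun o => lintegral_tsum_eq_of_isGraphUnimodular G (zdGraph_connected d) (isGraphTransitive_zdGraph d) (isGraphUnimodular_zdGraph d)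
      (labelMeasure (Site d)) (fun γ => actLabels γ) (fun γ => measurable_actLabels γ) (fun γ => labelMeasure_map_actLabels γ) hFmeas hFinv o
  have hout_eq : ∀ o U, (∑' w, F o w U) =
      ({w | Function.Injective U ∧ (SimpleGraph.fromEdgeSet (wmsf G U)).Reachable o w ∧ M U w}.encard : ℝ≥0∞) := fun o U => tsum_ite_eq_encard _
  have hin_eq : ∀ o U, (∑' u, F u o U) =
      ({u | Function.Injective U ∧ (SimpleGraph.fromEdgeSet (wmsf G U)).Reachable u o ∧ M U o}.encard : ℝ≥0∞) := fun o U => tsum_ite_eq_encard _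
  have hgood := ((Literature.Barriers.CriticalPhenomena.ae_injective_labelMeasure (V := Site d)).and (ae_forall_root_existsUnique_ray hd)).and
    (ae_encard_trunkChildren_le_one hd)
  refine ae_all_iff.2 fun o => ?_
  -- out-mass ≤ 1 a.s.
  have hle_one : ∀ᵐ U ∂(labelMeasure (Site d)), (∑' w, F o w U) ≤ 1 := by
    filter_upwards [hgood] with U hU
    obtain ⟨⟨hUinj, hall⟩, hnb⟩ := hU
    rw [hout_eq]
    have h := encard_marked_le_one zdGraph_preconnected_holds hUinj (fun v => (hall v).1) (fun v => (hall v).2) hnb t o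
    have hsub : {w | Function.Injective U ∧ (SimpleGraph.fromEdgeSet (wmsf G U)).Reachable o w ∧ M U w} ⊆
        {w | (openGraph (wmsf G U)).Reachable o w ∧ M U w} := fun w hw => ⟨hw.2.1, hw.2.2⟩
    exact_mod_cast (Set.encard_le_encard hsub).trans h
  have hfin : ∫⁻ U, ∑' u, F u o U ∂(labelMeasure (Site d)) ≠ ∞ := by
    rw [← hMTP o]
    refine ne_top_of_le_ne_top (by simp) (?_ : _ ≤ ∫⁻ _, (1 : ℝ≥0∞) ∂(labelMeasure (Site d)))
    exact lintegral_mono_ae hle_one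
  have hmeas_in : Measurable fun U => ∑' u, F u o U := by
    have : (fun U => ∑' u, F u o U) = fun U => ⨆ s : Finset (Site d), ∑ u ∈ s, F u o U :=
      funext fun U => ENNReal.tsum_eq_iSup_sum
    rw [this]
    exact Measurable.iSup fun s => Finset.measurable_sum s fun u _ => hFmeas u o
  -- in-mass finite a.s.; it is infinite when `o` is marked
  filter_upwards [ae_lt_top hmeas_in hfin, hgood] with U hlt hU
  obtain ⟨⟨hUinj, hall⟩, -⟩ := hU
  intro hMo
  rw [hin_eq] at hlt
  obtain ⟨R, hR, hR0, hRadj⟩ := (hall o).2.exists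
  have hinf : {u | Function.Injective U ∧ (SimpleGraph.fromEdgeSet (wmsf G U)).Reachable u o ∧ M U o}.Infinite := by
    refine (infinite_component hUinj.injOn hR hR0 hRadj).mono fun u hu => ⟨hUinj, hu, hMo⟩
  rw [hinf.encard_eq] at hlt
  exact absurd hlt (by simp)

/-! ## §3 One end -/

/-- **EVERY COMPONENT OF THE WIRED MINIMAL SPANNING FOREST OF `ℤ^d` HAS EXACTLY ONE END** (`d ≥ 2`; Lyons–Peres 2016 Thm. 11.12 = Lyons–Peres–Schramm 2006
Thm. 3.12 / Thm. 1.1, whose hypothesis `θ(p_c) = 0` is p205010 on `ℤ^d`): almost surely, from EVERY vertex `v ∈ ℤ^d` there is EXACTLY ONE self-avoiding ray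
in `𝔉_w(U)` (namely the backbone of the invasion tree `T(v)`).  Proof (the book's, on `ℤ^d`): a second ray forces a descending trunk chain (file II) carrying a bond with
label `> p_c` — otherwise the chain is an infinite `p_c`-open path — hence, for a rational `t` in between, a marked vertex at level `t` (labels up a backbone are
eventually `≤ t`, file XL / I); but almost surely no vertex is marked (§2). [cite: LyonsPeres2016, Thm. 11.12] [cite: LyonsPeresSchramm2006, Thm. 1.1 and Thm. 3.12] -/
theorem ae_wmsf_oneEnded (hd : 2 ≤ d) :
    ∀ᵐ U ∂(labelMeasure (Site d)), ∀ v : Site d,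
      ∃! ρ : ℕ → Site d, Function.Injective ρ ∧ ρ 0 = v ∧ ∀ i, (SimpleGraph.fromEdgeSet (wmsf (zdGraph d) U)).Adj (ρ i) (ρ (i + 1)) := by
  classical
  haveI : Nonempty (Fin d) := ⟨⟨0, by omega⟩⟩
  haveI : Infinite (Site d) := Pi.infinite_of_right
  have hM : ∀ᵐ U ∂(labelMeasure (Site d)), ∀ q : ℚ, ∀ w : Site d,
      ¬ ((∃ y, InfBranch (treeEdges (zdGraph d) U w) w y ∧ InfBranch (wmsf (zdGraph d) U) y w ∧ (q : ℝ) < U s(w, y)) ∧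
          ∀ z, z ≠ w → ∀ y', InfBranch (treeEdges (zdGraph d) U z) z y' →
            w ∈ openClusterIn (withinGraph ⊤ ({y'} : Set (Site d))ᶜ) (wmsf (zdGraph d) U) z → U s(z, y') ≤ q) :=
    ae_all_iff.2 fun q => ae_not_marked hd q
  filter_upwards [Literature.Barriers.CriticalPhenomena.ae_injective_labelMeasure (V := Site d), ae_forall_root_existsUnique_ray hd, hM,
    ae_forall_root_eventually_acceptedLabel_le_real hd,
    ae_forall_not_percolatesAt_configOfLabels_of_theta_eq_zero (d := d) (criticalProbI d) (CSH.percolationContinuity_allDimensions d hd)]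
    with U hUinj hall hMU hev hperc
  have hex : ∀ v : Site d, ∃ R : ℕ → Site d, Function.Injective R ∧ R 0 = v ∧ ∀ i, (tree (zdGraph d) U v).Adj (R i) (R (i + 1)) :=
    fun v => (hall v).2.exists
  choose R hR hR0 hRadj using hex
  have hRspec : ∀ v, Function.Injective (R v) ∧ R v 0 = v ∧ ∀ i, (tree (zdGraph d) U v).Adj (R v i) (R v (i + 1)) :=
    fun v => ⟨hR v, hR0 v, hRadj v⟩
  have hout : ∀ v : Site d, ∀ k, ∃ m, k ≤ m ∧ IsOutlet (zdGraph d) U v m := fun v => (hall v).1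
  have hray := fun v => (hall v).2
  obtain ⟨hF, h0, hinj, hadjF, hcoh, htail, -⟩ := rayField_props zdGraph_preconnected_holds hUinj hout hray hRspec
  intro v
  refine ⟨R v, ⟨hinj v, h0 v, hadjF v⟩, fun ρ hρ => ?_⟩
  obtain ⟨hρinj, hρ0, hρadj⟩ := hρ
  by_contra hne
  obtain ⟨j, -, hchain⟩ := trunk_chain_of_ray hF h0 hinj hadjF hcoh htail hρinj hρ0 hρadj hne
  -- some bond of the descending chain has label `> p_c` (else an infinite `p_c`-open path from `ρ j`)
  have hlab : ∃ n, j ≤ n ∧ criticalProb (zdGraph d) (0 : Site d) < U s(ρ (n + 1), ρ n) := by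
    by_contra hcon
    simp only [not_exists, not_and, not_lt] at hcon
    apply hperc (ρ j)
    show (openCluster (configOfLabels ((criticalProbI d : unitInterval) : ℝ) U (zdGraph d)) (ρ j)).Infinite
    have hreach : ∀ n, j ≤ n → (openGraph (configOfLabels ((criticalProbI d : unitInterval) : ℝ) U (zdGraph d))).Reachable (ρ j) (ρ n) := by
      intro n hn
      induction n, hn using Nat.le_induction with
      | base => exact SimpleGraph.Reachable.refl _
      | succ n hn ih =>
        refine ih.trans (SimpleGraph.Adj.reachable ?_)
        rw [openGraph_adj]
        refine ⟨⟨(SimpleGraph.mem_edgeSet _).2 (fromEdgeSet_wmsf_le U (hρadj n)), ?_⟩, (hρadj n).ne⟩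
        rw [Sym2.eq_swap, coe_criticalProbI]
        exact hcon n hn
    refine ((Set.Ici_infinite j).image hρinj.injOn).mono ?_
    rintro _ ⟨n, hn, rfl⟩
    exact hreach n hn
  obtain ⟨n, hn, hlab⟩ := hlab
  obtain ⟨q, hq1, hq2⟩ := exists_rat_btwn hlab
  -- the chain vertex `z = ρ (n+1)` is a trunk vertex with parent `ρ n` and parent bond label `> q`
  obtain ⟨hpar, -, -⟩ := hchain n hn
  obtain ⟨-, -, hztrunk⟩ := hchain (n + 1) (by omega)
  have hzt : (q : ℝ) < U s(R (ρ (n + 1)) 0, R (ρ (n + 1)) 1) := by rwa [h0, hpar]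
  have hev' : ∀ᶠ i in atTop, U s(R (ρ (n + 1)) i, R (ρ (n + 1)) (i + 1)) ≤ q :=
    eventually_label_ray_le (hev (ρ (n + 1)) q hq1) (hR _) (hRadj _)
  obtain ⟨w, -, hwtrunk, hwt, hwup⟩ := exists_marked hcoh hztrunk hzt hev'
  exact hMU q w ((marked_iff zdGraph_preconnected_holds hUinj hout hray hRspec q w).2 ⟨hwtrunk, hwt, hwup⟩)

/-- **No bi-infinite path**: almost surely the wired minimal spanning forest of `ℤ^d` (`d ≥ 2`) contains NO self-avoiding bi-infinite path — from the vertex `β 0` the two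
halves would be two distinct self-avoiding rays. [cite: LyonsPeres2016, Thm. 11.12 (the trunk of a two-ended component)] -/
theorem ae_wmsf_no_biInfinite_path (hd : 2 ≤ d) :
    ∀ᵐ U ∂(labelMeasure (Site d)), ∀ β : ℤ → Site d, Function.Injective β →
      ¬ ∀ i : ℤ, (SimpleGraph.fromEdgeSet (wmsf (zdGraph d) U)).Adj (β i) (β (i + 1)) := by
  filter_upwards [ae_wmsf_oneEnded hd] with U hU
  intro β hβ hadj
  obtain ⟨ρ, -, huniq⟩ := hU (β 0)
  have h1 : (fun k : ℕ => β k) = ρ := huniq _ ⟨fun i j hij => by exact_mod_cast hβ hij, by simp, fun i => by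
    have := hadj i; push_cast at this ⊢; exact this⟩
  have h2 : (fun k : ℕ => β (-(k : ℤ))) = ρ := huniq _ ⟨fun i j hij => by have := hβ hij; omega, by simp, fun i => by
    have := (hadj (-(i : ℤ) - 1)).symm
    rwa [show -(i : ℤ) - 1 + 1 = -(i : ℤ) by ring, show -(i : ℤ) - 1 = -((i + 1 : ℕ) : ℤ) by push_cast; ring] at this⟩
  have : β 1 = β (-1) := by
    have e1 := congrFun h1 1
    have e2 := congrFun h2 1
    simp only [Nat.cast_one] at e1 e2
    rw [e1, e2]
  have := hβ this
  omega

/-- `ℤ³`: almost surely every component of the wired minimal spanning forest of `ℤ³` has exactly one end — exactly one self-avoiding ray from every vertex.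
[cite: LyonsPeres2016, Thm. 11.12] [cite: LyonsPeresSchramm2006, Thm. 1.1] -/
theorem ae_wmsf_oneEnded_Z3 :
    ∀ᵐ U ∂(labelMeasure (Site 3)), ∀ v : Site 3,
      ∃! ρ : ℕ → Site 3, Function.Injective ρ ∧ ρ 0 = v ∧ ∀ i, (SimpleGraph.fromEdgeSet (wmsf (zdGraph 3) U)).Adj (ρ i) (ρ (i + 1)) :=
  ae_wmsf_oneEnded (d := 3) (by norm_num)

end Summit.CriticalPhenomena.PercolationContinuityZ3.Theorems.Rsw3
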